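import Mathlib.Data.Fintype.Fin
import Mathlib.Data.Finset.Card
import Literature.Computability.Complexity.CardinalityCNF
import HarnessLib

/-!
# CNFs with cardinality constraints (`CCNF`) and their expansion to a plain CNF over `ℕ`

The input format of the SAT-based nonexistence certificates (LRAT importer `LRATImport.lean`,
TPP encoder `Combinatorics/Additive/TripleProductPropertySAT.lean`): a `CCNF ν` is a CNF over a
structured variable type `ν` together with a list of cardinality constraints
"at least `bound` of the literals `lits` are true" (`CardConstraint`; "at most" is the case of
negated literals, `CardConstraint.atMost`). This file turns a `CCNF ν` into ONE plain `CNF ℕ`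
(DIMACS-ready) with the same satisfiability, all steps proved:

* `CCNF.expand Φ : CNF (ν ⊕ ℕ × ℕ × ℕ)` — the clauses of `Φ` on `Sum.inl`, plus, for the `t`-th
  cardinality constraint, the sequential counter of `CardinalityCNF.lean` on the auxiliary bits
  `Sum.inr (t, i, j)`; `CCNF.satisfiable_expand_iff` (sound: `seqCounter_sound`; complete: the
  explicit witness `CCNF.expandWitness`);
* `CCNF.toCNF Φ e n : CNF ℕ` — base variable `x ↦ e x` (any numbering injective on the occurring
  base variables with values `< n`), auxiliary bit `(t, i, j) ↦ n + (t·W + i)·D + j` densely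
  (`W = CCNF.width`, `D = CCNF.depth`); `CCNF.satisfiable_toCNF_iff`;
* `CCNF.toNatCNF` / `CCNF.satisfiable_toNatCNF_iff` — the case `ν = Fin m`, `e = Fin.val`;
* `subsetCNF m ψ k` / `subsetCNF_satisfiable_iff` — the **design-existence encoder**: for
  constraints `ψ : CNF (Fin m)` on the indicator variables of an unknown subset `D ⊆ Fin m`,
  `subsetCNF m ψ k` is satisfiable iff some `D` with `k ≤ |D|` satisfies `ψ`; so an UNSAT
  certificate for `subsetCNF m ψ k` proves that no such design of size `≥ k` exists.

## References

* C. Sinz, CP 2005, §2 (sequential counter). [cite: Sinz2005, §2]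
* Cardinality-constrained CNF as an input format (folklore; e.g. the `PB`/`WCNF` competitions).
-/

namespace Literature.Computability.Complexity

universe u

variable {ν : Type u}

/-! ### Cardinality constraints -/

/-- A cardinality constraint "at least `bound` of the literals `lits` are true". [folklore] -/
structure CardConstraint (ν : Type u) where
  /-- the threshold -/
  bound : ℕ
  /-- the literals counted (with multiplicity, in this order) -/
  lits : List (Literal ν)

namespace CardConstraint

/-- The constraint holds under `σ`: at least `bound` of its literals are true. [folklore] -/
def Holds (σ : ν → Bool) (cc : CardConstraint ν) : Prop :=
  cc.bound ≤ countTrue σ cc.lits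

/-- `Holds` is decidable (a numeric comparison). [folklore] -/
instance (σ : ν → Bool) (cc : CardConstraint ν) : Decidable (cc.Holds σ) :=
  inferInstanceAs (Decidable (cc.bound ≤ countTrue σ cc.lits))

/-- "At least `k` of the variables `xs` are true." [folklore] -/
def atLeast (k : ℕ) (xs : List ν) : CardConstraint ν :=
  ⟨k, xs.map fun x => (x, true)⟩

/-- "At most `k` of the variables `xs` are true", as "at least `|xs| - k` of them are false".
[folklore] -/
def atMost (k : ℕ) (xs : List ν) : CardConstraint ν :=
  ⟨xs.length - k, xs.map fun x => (x, false)⟩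

/-- Semantics of `atLeast`. [folklore] -/
theorem holds_atLeast_iff (σ : ν → Bool) (k : ℕ) (xs : List ν) :
    (atLeast k xs).Holds σ ↔ k ≤ xs.countP fun x => σ x := by
  rw [Holds, atLeast, countTrue_map_mk_true]

/-- Semantics of `atMost`. [folklore] -/
theorem holds_atMost_iff (σ : ν → Bool) (k : ℕ) (xs : List ν) :
    (atMost k xs).Holds σ ↔ (xs.countP fun x => σ x) ≤ k := by
  have hsplit := List.length_eq_countP_add_countP (fun x => σ x) (l := xs)
  have hfalse : countTrue σ (xs.map fun x => (x, false)) =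
      xs.countP fun a => decide ¬σ a = true := by
    simp only [countTrue, List.countP_map]
    congr 1
    funext x
    simp
  simp only [Holds, atMost, hfalse]
  omega

end CardConstraint

/-! ### CNFs with cardinality constraints -/

/-- A CNF together with a list of cardinality constraints over the same variables. [folklore] -/
structure CCNF (ν : Type u) where
  /-- the ordinary clauses -/
  clauses : CNF ν
  /-- the cardinality constraints -/
  cards : List (CardConstraint ν)

namespace CCNF

/-- `σ` satisfies `Φ`: all clauses are true and all cardinality constraints hold. [folklore] -/
def Satisfies (Φ : CCNF ν) (σ : ν → Bool) : Prop :=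
  Φ.clauses.eval σ = true ∧ ∀ cc ∈ Φ.cards, cc.Holds σ

/-- `Φ` is satisfiable. [folklore] -/
def Satisfiable (Φ : CCNF ν) : Prop :=
  ∃ σ : ν → Bool, Φ.Satisfies σ

/-! ### Expansion of the cardinality constraints by sequential counters -/

/-- The counter block of the `t`-th constraint, on the auxiliary bits `Sum.inr (t, i, j)`.
[cite: Sinz2005, §2] -/
def cardBlock (t : ℕ) (cc : CardConstraint ν) : CNF (ν ⊕ ℕ × ℕ × ℕ) :=
  (seqCounter cc.bound cc.lits).relabel (Sum.map id (Prod.mk t))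

/-- The counter blocks of the constraints `ccs`, numbered from `t`. [cite: Sinz2005, §2] -/
def expandAux : ℕ → List (CardConstraint ν) → CNF (ν ⊕ ℕ × ℕ × ℕ)
  | _, [] => []
  | t, cc :: ccs => cardBlock t cc ++ expandAux (t + 1) ccs

/-- **The plain-CNF expansion of a `CCNF`**: its clauses (on `Sum.inl`) and one sequential
counter per cardinality constraint (on `Sum.inr (t, ·, ·)`). [cite: Sinz2005, §2] -/
def expand (Φ : CCNF ν) : CNF (ν ⊕ ℕ × ℕ × ℕ) :=
  Φ.clauses.relabel Sum.inl ++ expandAux 0 Φ.cards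

/-- Soundness of the counter blocks: each constraint of `ccs` holds for the base part of a
satisfying assignment. [cite: Sinz2005, §2] -/
theorem expandAux_sound {τ : ν ⊕ ℕ × ℕ × ℕ → Bool} (ccs : List (CardConstraint ν)) {t : ℕ}
    (h : (expandAux t ccs).eval τ = true) : ∀ cc ∈ ccs, cc.Holds (τ ∘ Sum.inl) := by
  induction ccs generalizing t with
  | nil => simp
  | cons cc ccs ih =>
    simp only [expandAux, CNF.eval_append_eq_true_iff] at h
    intro cc' hcc'
    rcases List.mem_cons.1 hcc' with rfl | hcc'
    · have h1 := h.1
      rw [cardBlock, CNF.eval_relabel] at h1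
      have e : (τ ∘ Sum.map id (Prod.mk t)) ∘ Sum.inl = τ ∘ Sum.inl := by funext x; rfl
      have := seqCounter_sound h1
      rwa [e] at this
    · exact ih h.2 cc' hcc'

/-- **Soundness of the expansion**: the base part of a satisfying assignment of `Φ.expand`
satisfies `Φ`. [cite: Sinz2005, §2] -/
theorem expand_sound {Φ : CCNF ν} {τ : ν ⊕ ℕ × ℕ × ℕ → Bool} (h : Φ.expand.eval τ = true) :
    Φ.Satisfies (τ ∘ Sum.inl) := by
  simp only [expand, CNF.eval_append_eq_true_iff, CNF.eval_relabel] at h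
  exact ⟨h.1, expandAux_sound Φ.cards h.2⟩

/-- The witness extension of a base assignment to all counter blocks of the constraints `ccs`
(block `t` uses the counter witness of the `t`-th constraint). [cite: Sinz2005, §2] -/
def expandWitness (ccs : List (CardConstraint ν)) (σ : ν → Bool) : ν ⊕ ℕ × ℕ × ℕ → Bool
  | Sum.inl x => σ x
  | Sum.inr (t, p) =>
    match ccs[t]? with
    | some cc => seqCounterWitness σ cc.lits (Sum.inr p)
    | none => false

/-- On block `t` the witness is the counter witness of the `t`-th constraint. [cite: Sinz2005, §2] -/
theorem expandWitness_comp (ccs : List (CardConstraint ν)) (σ : ν → Bool) {t : ℕ}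
    {cc : CardConstraint ν} (ht : ccs[t]? = some cc) :
    expandWitness ccs σ ∘ Sum.map id (Prod.mk t) = seqCounterWitness σ cc.lits := by
  funext x
  rcases x with x | ⟨i, j⟩
  · rfl
  · simp [expandWitness, ht]

/-- Completeness of the counter blocks under the witness. [cite: Sinz2005, §2] -/
theorem expandAux_complete (σ : ν → Bool) (done ccs : List (CardConstraint ν))
    (h : ∀ cc ∈ ccs, cc.Holds σ) :
    (expandAux done.length ccs).eval (expandWitness (done ++ ccs) σ) = true := by
  induction ccs generalizing done with
  | nil => rfl
  | cons cc ccs ih =>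
    simp only [expandAux, CNF.eval_append_eq_true_iff]
    refine ⟨?_, ?_⟩
    · have ht : (done ++ cc :: ccs)[done.length]? = some cc := by simp
      rw [cardBlock, CNF.eval_relabel, expandWitness_comp _ σ ht]
      exact seqCounter_complete (h cc List.mem_cons_self)
    · have := ih (done ++ [cc]) fun cc' hcc' => h cc' (List.mem_cons_of_mem _ hcc')
      simpa using this

/-- **Completeness of the expansion**: a satisfying assignment of `Φ` extends (by
`expandWitness`) to one of `Φ.expand`. [cite: Sinz2005, §2] -/
theorem expand_complete {Φ : CCNF ν} {σ : ν → Bool} (h : Φ.Satisfies σ) :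
    Φ.expand.eval (expandWitness Φ.cards σ) = true := by
  simp only [expand, CNF.eval_append_eq_true_iff, CNF.eval_relabel]
  exact ⟨h.1, by simpa using expandAux_complete σ [] Φ.cards h.2⟩

/-- **The expansion is equisatisfiable with the `CCNF`.** [cite: Sinz2005, §2] -/
theorem satisfiable_expand_iff (Φ : CCNF ν) : Φ.expand.Satisfiable ↔ Φ.Satisfiable :=
  ⟨fun ⟨_, hτ⟩ => ⟨_, expand_sound hτ⟩, fun ⟨_, hσ⟩ => ⟨_, expand_complete hσ⟩⟩

/-! ### The variables of the expansion -/

/-- The base variables of a `CCNF`: those of its clauses and of its cardinality constraints.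
[folklore] -/
def baseVarSet (Φ : CCNF ν) : Set ν :=
  Φ.clauses.varSet ∪ {x | ∃ cc ∈ Φ.cards, ∃ l ∈ cc.lits, l.1 = x}

/-- Width bound of the auxiliary bit index `i`: one more than the longest literal list.
[folklore] -/
def width (Φ : CCNF ν) : ℕ :=
  (Φ.cards.map fun cc => cc.lits.length).foldr max 0 + 1

/-- Depth bound of the auxiliary bit index `j`: one more than the largest threshold. [folklore] -/
def depth (Φ : CCNF ν) : ℕ :=
  (Φ.cards.map fun cc => cc.bound).foldr max 0 + 1

/-- Members of a list of naturals are bounded by its `foldr max 0`. [folklore] -/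
private theorem le_foldr_max_of_mem {L : List ℕ} {a : ℕ} (h : a ∈ L) : a ≤ L.foldr max 0 := by
  induction L with
  | nil => simp at h
  | cons b L ih =>
    simp only [List.foldr_cons]
    rcases List.mem_cons.1 h with rfl | h
    · exact le_max_left _ _
    · exact (ih h).trans (le_max_right _ _)

/-- The variables of the counter blocks numbered from `t`. [cite: Sinz2005, §2] -/
theorem mem_varSet_expandAux (ccs : List (CardConstraint ν)) {t : ℕ} {x : ν ⊕ ℕ × ℕ × ℕ}
    (hx : x ∈ (expandAux t ccs).varSet) :
    (∃ cc ∈ ccs, ∃ l ∈ cc.lits, x = Sum.inl l.1) ∨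
      ∃ t' i j, t ≤ t' ∧ t' < t + ccs.length ∧ (∃ cc ∈ ccs, i ≤ cc.lits.length ∧ j ≤ cc.bound) ∧
        x = Sum.inr (t', i, j) := by
  induction ccs generalizing t with
  | nil => simp [expandAux, CNF.varSet] at hx
  | cons cc ccs ih =>
    simp only [expandAux, CNF.varSet_append, Set.mem_union] at hx
    rcases hx with hx | hx
    · rw [cardBlock, CNF.varSet_relabel] at hx
      obtain ⟨y, hy, rfl⟩ := hx
      rcases mem_varSet_seqCounter hy with ⟨l, hl, rfl⟩ | ⟨i, j, hi, hj, rfl⟩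
      · exact Or.inl ⟨cc, List.mem_cons_self, l, hl, rfl⟩
      · exact Or.inr ⟨t, i, j, le_rfl, by simp, ⟨cc, List.mem_cons_self, hi, hj⟩, rfl⟩
    · rcases ih hx with ⟨cc', hcc', l, hl, rfl⟩ | ⟨t', i, j, ht', ht'', ⟨cc', hcc', hi, hj⟩, rfl⟩
      · exact Or.inl ⟨cc', List.mem_cons_of_mem _ hcc', l, hl, rfl⟩
      · refine Or.inr ⟨t', i, j, by omega, ?_, ⟨cc', List.mem_cons_of_mem _ hcc', hi, hj⟩, rfl⟩
        simp at ht'' ⊢; omega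

/-- **The variables of `Φ.expand`**: base variables on `Sum.inl`, and auxiliary bits
`Sum.inr (t, i, j)` with `t < |cards|`, `i < width`, `j < depth`. [cite: Sinz2005, §2] -/
theorem mem_varSet_expand (Φ : CCNF ν) {x : ν ⊕ ℕ × ℕ × ℕ} (hx : x ∈ Φ.expand.varSet) :
    (∃ y ∈ Φ.baseVarSet, x = Sum.inl y) ∨
      ∃ t i j, t < Φ.cards.length ∧ i < Φ.width ∧ j < Φ.depth ∧ x = Sum.inr (t, i, j) := by
  simp only [expand, CNF.varSet_append, Set.mem_union] at hx
  rcases hx with hx | hx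
  · rw [CNF.varSet_relabel] at hx
    obtain ⟨y, hy, rfl⟩ := hx
    exact Or.inl ⟨y, Or.inl hy, rfl⟩
  · rcases mem_varSet_expandAux Φ.cards hx with ⟨cc, hcc, l, hl, rfl⟩ |
        ⟨t', i, j, -, ht'', ⟨cc, hcc, hi, hj⟩, rfl⟩
    · exact Or.inl ⟨l.1, Or.inr ⟨cc, hcc, l, hl, rfl⟩, rfl⟩
    · refine Or.inr ⟨t', i, j, by simpa using ht'', ?_, ?_, rfl⟩
      · have := le_foldr_max_of_mem (List.mem_map.2 ⟨cc, hcc, rfl⟩ :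
          cc.lits.length ∈ Φ.cards.map fun cc => cc.lits.length)
        unfold width; omega
      · have := le_foldr_max_of_mem (List.mem_map.2 ⟨cc, hcc, rfl⟩ :
          cc.bound ∈ Φ.cards.map fun cc => cc.bound)
        unfold depth; omega

/-! ### Dense renumbering to `ℕ` -/

/-- Mixed-radix uniqueness: `a·D + j = b·D + j'` with `j, j' < D` forces `a = b`, `j = j'`
(private twin of `HastadPV.Coding.mul_add_inj`, whose import closure is not wanted here).
[folklore] -/
private theorem mixedRadix_inj {D a b j j' : ℕ} (hj : j < D) (hj' : j' < D)
    (h : a * D + j = b * D + j') : a = b ∧ j = j' := by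
  have hD : 0 < D := lt_of_le_of_lt (Nat.zero_le j) hj
  have ha : (j + a * D) / D = a := by
    rw [Nat.add_mul_div_right _ _ hD, Nat.div_eq_of_lt hj, Nat.zero_add]
  have hb : (j' + b * D) / D = b := by
    rw [Nat.add_mul_div_right _ _ hD, Nat.div_eq_of_lt hj', Nat.zero_add]
  have hab : a = b := by
    rw [← ha, ← hb, Nat.add_comm j, Nat.add_comm j', h]
  subst hab
  exact ⟨rfl, by omega⟩

/-- The dense index of the auxiliary bit `(t, i, j)` after the `n` base variables:
`n + (t·W + i)·D + j`. [folklore] -/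
def auxIndex (Φ : CCNF ν) (n : ℕ) (p : ℕ × ℕ × ℕ) : ℕ :=
  n + (p.1 * Φ.width + p.2.1) * Φ.depth + p.2.2

/-- **The plain CNF over `ℕ` of a `CCNF`**: expand the cardinality constraints and renumber,
base variable `x ↦ e x`, auxiliary bits densely from `n` on (`auxIndex`). [cite: Sinz2005, §2] -/
def toCNF (Φ : CCNF ν) (e : ν → ℕ) (n : ℕ) : CNF ℕ :=
  Φ.expand.relabel (Sum.elim e (Φ.auxIndex n))

/-- The renumbering is injective on the variables of the expansion, provided `e` is injective on
the base variables and maps them below `n`. [folklore] -/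
theorem injOn_numbering (Φ : CCNF ν) {e : ν → ℕ} {n : ℕ} (he : Set.InjOn e Φ.baseVarSet)
    (hn : ∀ y ∈ Φ.baseVarSet, e y < n) :
    Set.InjOn (Sum.elim e (Φ.auxIndex n)) Φ.expand.varSet := by
  intro x hx x' hx' hxx'
  rcases Φ.mem_varSet_expand hx with ⟨y, hy, rfl⟩ | ⟨t, i, j, -, hi, hj, rfl⟩ <;>
    rcases Φ.mem_varSet_expand hx' with ⟨y', hy', rfl⟩ | ⟨t', i', j', -, hi', hj', rfl⟩
  · simp only [Sum.elim_inl] at hxx'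
    rw [he hy hy' hxx']
  · simp only [Sum.elim_inl, Sum.elim_inr, auxIndex] at hxx'
    have := hn y hy; omega
  · simp only [Sum.elim_inl, Sum.elim_inr, auxIndex] at hxx'
    have := hn y' hy'; omega
  · simp only [Sum.elim_inr, auxIndex] at hxx'
    have h1 : (t * Φ.width + i) * Φ.depth + j = (t' * Φ.width + i') * Φ.depth + j' := by omega
    obtain ⟨h2, rfl⟩ := mixedRadix_inj hj hj' h1
    obtain ⟨rfl, rfl⟩ := mixedRadix_inj hi hi' h2
    rfl

/-- **`CCNF.toCNF` is equisatisfiable with the `CCNF`** (for a base numbering `e` injective on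
the occurring base variables with values `< n`). [cite: Sinz2005, §2] -/
theorem satisfiable_toCNF_iff (Φ : CCNF ν) {e : ν → ℕ} {n : ℕ} (he : Set.InjOn e Φ.baseVarSet)
    (hn : ∀ y ∈ Φ.baseVarSet, e y < n) : (Φ.toCNF e n).Satisfiable ↔ Φ.Satisfiable := by
  rw [toCNF, CNF.satisfiable_relabel_iff_of_injOn (Φ.injOn_numbering he hn),
    satisfiable_expand_iff]

/-- `CCNF.toCNF` is equisatisfiable with the `CCNF` — version for a globally injective
numbering bounded by `n`. [cite: Sinz2005, §2] -/
theorem satisfiable_toCNF_iff' (Φ : CCNF ν) {e : ν → ℕ} {n : ℕ} (he : Function.Injective e)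
    (hn : ∀ y, e y < n) : (Φ.toCNF e n).Satisfiable ↔ Φ.Satisfiable :=
  Φ.satisfiable_toCNF_iff he.injOn fun y _ => hn y

/-- The plain CNF over `ℕ` of a `CCNF` over `Fin m`: base variable `i ↦ i`, auxiliary bits from
`m` on. [cite: Sinz2005, §2] -/
def toNatCNF {m : ℕ} (Φ : CCNF (Fin m)) : CNF ℕ :=
  Φ.toCNF Fin.val m

/-- **`CCNF.toNatCNF` is equisatisfiable with the `CCNF`.** [cite: Sinz2005, §2] -/
theorem satisfiable_toNatCNF_iff {m : ℕ} (Φ : CCNF (Fin m)) :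
    Φ.toNatCNF.Satisfiable ↔ Φ.Satisfiable :=
  Φ.satisfiable_toCNF_iff' Fin.val_injective Fin.isLt

end CCNF

/-! ### The subset-design encoder -/

/-- **Subset-design CNF**: for constraints `ψ` on the indicator variables `i : Fin m` of an
unknown subset `D ⊆ Fin m` and a size threshold `k`, the plain CNF over `ℕ` "`ψ` holds and at
least `k` indicators are true" (variables `0 … m-1` are the indicators, the rest are counter
bits). See `subsetCNF_satisfiable_iff`. [cite: Sinz2005, §2] -/
def subsetCNF (m : ℕ) (ψ : CNF (Fin m)) (k : ℕ) : CNF ℕ :=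
  (CCNF.mk ψ [CardConstraint.atLeast k (List.finRange m)]).toNatCNF

/-- Counting over `List.finRange` is the cardinality of the filtered `Finset.univ`. [folklore] -/
theorem countP_finRange_eq_card_filter {m : ℕ} (p : Fin m → Bool) :
    (List.finRange m).countP p = (Finset.univ.filter fun i => p i = true).card := by
  rw [Fin.univ_def, List.countP_eq_length_filter]
  simp only [Finset.filter_val, Finset.card]
  rw [Multiset.filter_coe, Multiset.coe_card]
  congr 1
  exact List.filter_congr fun x _ => by simp

/-- **The subset-design encoder is exact**: `subsetCNF m ψ k` is satisfiable iff there is a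
subset `D ⊆ Fin m` with `k ≤ |D|` whose indicator assignment satisfies `ψ`. Consequently an
UNSAT certificate for `subsetCNF m ψ k` proves that every `D` satisfying `ψ` has `|D| < k`.
[cite: Sinz2005, §2] -/
theorem subsetCNF_satisfiable_iff (m : ℕ) (ψ : CNF (Fin m)) (k : ℕ) :
    (subsetCNF m ψ k).Satisfiable ↔
      ∃ D : Finset (Fin m), k ≤ D.card ∧ ψ.eval (fun i => decide (i ∈ D)) = true := by
  rw [subsetCNF, CCNF.satisfiable_toNatCNF_iff]
  constructor
  · rintro ⟨σ, hψ, hcard⟩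
    have hc := hcard _ List.mem_cons_self
    rw [CardConstraint.holds_atLeast_iff, countP_finRange_eq_card_filter] at hc
    have : ψ.eval (fun i => decide (i ∈ Finset.univ.filter fun i => σ i = true)) = ψ.eval σ :=
      CNF.eval_congr_varSet fun x _ => by simp
    exact ⟨_, hc, this.trans hψ⟩
  · rintro ⟨D, hk, hψ⟩
    refine ⟨fun i => decide (i ∈ D), hψ, ?_⟩
    intro cc hcc
    simp only [List.mem_singleton] at hcc
    subst hcc
    rw [CardConstraint.holds_atLeast_iff, countP_finRange_eq_card_filter]
    simpa using hk

end Literature.Computability.Complexity
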